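import Summits.QuantumFields.YangMills.Theorems.BalabanLadderUVSeamRecStubTransport
import HarnessLib

/-!
# Crux `UVSeamRec` (stmt-QuantumFields-20043): `IsCompactSimpleLieGroup` is invariant under topological group isomorphisms

Helper file (`--supports stmt-QuantumFields-20043`) of the lead prover (unit `ym-spine-20043-p1`).  In the closed-form
composition `UVSeamRec_of` of the `UVSeamRec` skeleton the group `G` comes with `hG : IsCompactSimpleLieGroup G` and an
isomorphism `e : G ≃ₜ* SU(2)`; engine items stated for compact simple groups (e.g. `Statement.stub_fcp6`, consumed by
`FloorsC.stubFloors_of_femtoEngine`) are then invoked AT `SU(2)`, which needs `IsCompactSimpleLieGroup SU(2)` — obtained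
here by transport along `e` rather than from the tree's named (unproved) fact `isSimpleCompactGroup_specialUnitaryGroup`.

* `isSimpleCompactGroup_of_continuousMulEquiv` — connectedness, non-commutativity and the triviality of closed connected
  normal subgroups pass along `e : G ≃ₜ* H`;
* `isCompactSimpleLieGroup_of_continuousMulEquiv` — together with a faithful unitary representation (`Transport.pull e.symm r`).
-/

set_option autoImplicit false

noncomputable section

open Topology
open Literature.MathematicalPhysics.QuantumFieldTheory Literature.MathematicalPhysics.QuantumLattice

namespace Summit.QuantumFields.YangMills.Cruxes.UVSeamRec.SimpleTransport

variable {G H : Type} [Group G] [TopologicalSpace G] [IsTopologicalGroup G] [CompactSpace G]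
  [Group H] [TopologicalSpace H] [IsTopologicalGroup H] [CompactSpace H]

omit [IsTopologicalGroup G] [CompactSpace G] [IsTopologicalGroup H] [CompactSpace H] in
/-- **Simplicity (compact-group sense) passes along a topological group isomorphism.** [folklore] -/
theorem isSimpleCompactGroup_of_continuousMulEquiv (e : G ≃ₜ* H) (hG : IsSimpleCompactGroup G) :
    IsSimpleCompactGroup H := by
  obtain ⟨hconn, ⟨a, b, hab⟩, hnormal⟩ := hG
  refine ⟨?_, ⟨e a, e b, fun h => hab ?_⟩, fun N hN hNc hNp => ?_⟩
  · -- connectedness: `univ = e '' univ` is connected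
    rw [connectedSpace_iff_univ]
    have h1 : IsConnected (Set.univ : Set G) := isConnected_univ
    have h2 := h1.image e e.continuous.continuousOn
    rwa [Set.image_univ, EquivLike.range_eq_univ] at h2
  · -- non-commutativity
    apply e.injective
    rw [map_mul, map_mul, h]
  · -- closed connected normal subgroups: pull back along `e`
    set N' : Subgroup G := N.comap e.toMulEquiv.toMonoidHom with hN'
    have hmem : ∀ g : G, g ∈ N' ↔ e g ∈ N := fun g => Iff.rfl
    haveI : N.Normal := hN
    have hN'normal : N'.Normal := by rw [hN']; infer_instance
    have hset : (N' : Set G) = e ⁻¹' (N : Set H) := rfl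
    have hN'closed : IsClosed (N' : Set G) := by
      rw [hset]; exact hNc.preimage e.continuous
    have hN'pre : IsPreconnected (N' : Set G) := by
      rw [hset]
      have himg := hNp.image e.symm e.symm.continuous.continuousOn
      have heq : (e.symm : H → G) '' (N : Set H) = e ⁻¹' (N : Set H) := by
        ext g
        constructor
        · rintro ⟨h, hh, rfl⟩
          show e (e.symm h) ∈ (N : Set H)
          rwa [e.apply_symm_apply]
        · intro hg
          exact ⟨e g, hg, e.symm_apply_apply g⟩
      rwa [heq] at himg
    rcases hnormal N' hN'normal hN'closed hN'pre with hbot | htop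
    · left
      refine (Subgroup.eq_bot_iff_forall N).2 fun h hh => ?_
      have h1 : e.symm h ∈ N' := by
        rw [hmem, e.apply_symm_apply]; exact hh
      rw [hbot] at h1
      have h2 : e.symm h = 1 := (Subgroup.mem_bot).1 h1
      calc h = e (e.symm h) := (e.apply_symm_apply h).symm
        _ = 1 := by rw [h2, map_one]
    · right
      refine (Subgroup.eq_top_iff' N).2 fun h => ?_
      have h1 : e.symm h ∈ N' := by rw [htop]; exact Subgroup.mem_top _
      rw [hmem, e.apply_symm_apply] at h1
      exact h1

omit [IsTopologicalGroup G] [IsTopologicalGroup H] in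
/-- **`IsCompactSimpleLieGroup` passes along a topological group isomorphism** (simplicity by
`isSimpleCompactGroup_of_continuousMulEquiv`, the faithful unitary representation pulled back along `e.symm`). [folklore] -/
theorem isCompactSimpleLieGroup_of_continuousMulEquiv (e : G ≃ₜ* H) (hG : IsCompactSimpleLieGroup G) :
    IsCompactSimpleLieGroup H := by
  obtain ⟨hsimple, ⟨r⟩⟩ := hG
  refine ⟨isSimpleCompactGroup_of_continuousMulEquiv e hsimple, ⟨?_⟩⟩
  exact r.comap e.symm.toMulEquiv.toMonoidHom e.symm.continuous_toFun
    (by simpa only [MulEquiv.coe_toMonoidHom] using e.symm.toMulEquiv.injective)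

omit [IsTopologicalGroup G] in
/-- The `SU(2)` instance used by the skeleton: `G ≃ₜ* SU(2)` compact simple ⇒ `SU(2)` compact simple. [folklore] -/
theorem isCompactSimpleLieGroup_su2_of_equiv (e : G ≃ₜ* Matrix.specialUnitaryGroup (Fin 2) ℂ)
    (hG : IsCompactSimpleLieGroup G) : IsCompactSimpleLieGroup (Matrix.specialUnitaryGroup (Fin 2) ℂ) :=
  isCompactSimpleLieGroup_of_continuousMulEquiv e hG

end Summit.QuantumFields.YangMills.Cruxes.UVSeamRec.SimpleTransport

end
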